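import Literature.AlgebraicGeometry.Motives.ProjectiveSpaceFunctionField
import Mathlib.Algebra.MvPolynomial.Division
import Mathlib.Algebra.Prime.Lemmas
import Mathlib.Data.Sym.Card
import Mathlib.Data.Finsupp.Multiset
import HarnessLib

/-!
# Sections of `𝒪(n)` on projective space: `h⁰(ℙ^d_K, 𝒪(n)) = C(n + d, d)`

In the concrete model of `Motives/CartierDivisor` (Cartier divisors on an integral scheme and their
spaces of sections inside the function field) this file computes the sections of the multiples of
the hyperplane divisor `H = {x₀ = 0}` on `ℙ^d_K = Proj K[x₀, …, x_d]` over a field `K`: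

* `ProjSpace.hyperplane` — `H`, the divisor of the generating section `x₀` of `𝒪(1)`
  (`GeneratingSections.divisor` of the generating sections of `𝟙 ℙ^d`; local equation `x₀/x_l` on
  `D₊(x_l)`); it is ample (`ProjSpace.isAmple_hyperplane`);
* `ProjSpace.formToSections n : K[x]_n ≃ₗ[K] Γ(ℙ^d, 𝒪(n • H))`, `F ↦ F/x₀ⁿ` — **the sections of
  `𝒪(n)` are the forms of degree `n`** (Görtz–Wedhorn I, Example 13.16: `Γ(ℙⁿ_R, 𝒪(d)) = R[X]_d`;
  Hartshorne II Prop. 5.13); injectivity is clear, and a section `s`, being regular on `D₊(x₀)`, is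
  `G/x₀^m` with `G` a form of degree `m` (`Γ(D₊(x₀), 𝒪) = (K[x]_{(x₀)})₀`); regularity of
  `(x₀/x₁)ⁿ s` on `D₊(x₁)` forces `x₀^{m-n} ∣ G` in the factorial ring `K[x]` (read off in the joint
  chart `(K[x]_{(x₀x₁)})₀`, Mathlib `MvPolynomial.X_prime`);
* `ProjSpace.finrank_homogeneousSubmodule` — `dim_K K[x₀,…,x_d]_n = C(n + d, d)` (monomials of
  degree `n` ↔ `Sym (Fin (d+1)) n`, Mathlib `Sym.card_sym_eq_multichoose`);
* `ProjSpace.h0_hyperplane` — hence **`h⁰(ℙ^d_K, 𝒪(n • H)) = C(n + d, d)`** for all `n`, and the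
  spaces of sections are finite-dimensional.

These are the values of `h⁰` on the comparison space `ℙ^d` in the cohomology-free proof of
Görtz–Wedhorn II, Prop. 23.83 (`CartierDivisor.asymptoticRiemannRoch_of_isAmple`) pursued in this
directory.

## References

* U. Görtz, T. Wedhorn, *Algebraic Geometry I: Schemes*, 2nd ed. (2020),
  doi:10.1007/978-3-658-30733-2: Example 13.16 (`Γ(ℙⁿ_R, 𝒪(d)) = R[X₀,…,Xₙ]_d`), (13.5)
  (`𝒪(n)` and the twisting sheaves), Example 11.45 (divisors on projective space, `𝒪(n)`).
  [GortzWedhorn2020]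
* R. Hartshorne, *Algebraic Geometry*, GTM 52 (1977), II Prop. 5.13. [Hartshorne1977]
-/

universe u

open CategoryTheory AlgebraicGeometry Limits HomogeneousLocalization TopologicalSpace Opposite
open MvPolynomial (X C)
open Literature.AlgebraicGeometry.Motives.Segre Literature.AlgebraicGeometry.Motives.RatFn

attribute [local instance] MvPolynomial.gradedAlgebra

noncomputable section

namespace Literature.AlgebraicGeometry.Motives

namespace ProjSpace

variable {d : ℕ} {K : Type u} [Field K]

/-! ### The hyperplane divisor -/

/-- The generating sections `x₀, …, x_d` of `𝒪(1)` on `ℙ^d`, in chart form: those of the morphism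
`𝟙 ℙ^d` (`GeneratingSections.ofHom`). [folklore] -/
abbrev gens : GeneratingSections (Fin (d + 1)) (P d K) := GeneratingSections.ofHom (𝟙 (P d K))

variable (d K) in
/-- **The hyperplane divisor `H = {x₀ = 0}` on `ℙ^d_K`**: the (effective Cartier) divisor of the
generating section `x₀` of `𝒪(1)`, with local equation `x₀/x_l` on `D₊(x_l)` (Görtz–Wedhorn I,
Example 11.45; `GeneratingSections.divisor`). [folklore] -/
def hyperplane : CartierDivisor (P d K) :=
  (gens (d := d) (K := K)).divisor 0 (genericPoint_mem_U 0)

/-- The charts of `H` are the `D₊(x_l)` (unfolding). [folklore] -/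
theorem hyperplane_U (i : (hyperplane d K).ι) : (hyperplane d K).U i = U i.down.1 := rfl

/-- The local equation of `H` on `D₊(x_l)` is the rational function `x₀/x_l` (unfolding). [folklore] -/
theorem hyperplane_f (i : (hyperplane d K).ι) :
    (hyperplane d K).f i = awayToFunctionField i.down.1 (frac K i.down.1 0) := rfl

/-- The hyperplane divisor is ample (`𝒪(1)` is: the `D₊(x_l)` are affine and cover,
`GeneratingSections.isAmple_divisor`; Görtz–Wedhorn I, Example 13.45). [folklore] -/
theorem isAmple_hyperplane : (hyperplane d K).IsAmple :=
  GeneratingSections.isAmple_divisor _ 0 (genericPoint_mem_U 0)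
    (GeneratingSections.isAffineOpen_ofHom_U (𝟙 (P d K)))

/-! ### An identity between fractions -/

/-- In `(K[x]_{(x_l x_{l'})})₀`: `(x_{l'}/x_l)ⁿ · F/x_{l'}ⁿ = F/x_lⁿ` for a form `F` of degree `n`.
[folklore] -/
theorem awayMap_frac_pow_mul_awayMap_mk (l l' : Fin (d + 1)) (n : ℕ)
    (F : MvPolynomial (Fin (d + 1)) K) (hF : F ∈ grading (Fin (d + 1)) K (n • 1)) :
    awayMap (grading (Fin (d + 1)) K) (X_mem K l') (rfl : X l * X l' = X l * X l') (frac K l l') ^ n *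
      awayMap (grading (Fin (d + 1)) K) (X_mem K l) (mul_comm (X l) (X l'))
        (Away.mk _ (X_mem K l') n F hF) =
      awayMap (grading (Fin (d + 1)) K) (X_mem K l') (rfl : X l * X l' = X l * X l')
        (Away.mk _ (X_mem K l) n F hF) := by
  apply val_injective
  simp only [val_mul, val_pow, frac, Away.isLocalizationElem, awayMap_mk, Away.val_mk,
    Localization.mk_pow, Localization.mk_mul]
  rw [Localization.mk_eq_mk_iff, Localization.r_iff_exists]
  refine ⟨1, ?_⟩
  simp only [OneMemClass.coe_one, one_mul, Submonoid.coe_mul, SubmonoidClass.coe_pow]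
  ring

/-! ### Forms of degree `n` as sections of `𝒪(n • H)` -/

/-- Dehomogenisation in the chart `D₊(x_l)` followed by passage to `K(ℙ^d)`:
`F ↦ F(x₀/x_l, …, x_d/x_l)`, a `K`-algebra map `K[x] → K(ℙ^d)` (on forms of degree `n` this is
`F ↦ F/x_lⁿ`, `formToFunctionField_of_mem`). [folklore] -/
def formToFunctionField (l : Fin (d + 1)) : MvPolynomial (Fin (d + 1)) K →ₐ[K] (P d K).functionField :=
  { (awayToFunctionField l).comp (MvPolynomial.eval₂Hom (cst K (X l)) (frac K l)) with
    commutes' := fun c => by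
      change awayToFunctionField l (MvPolynomial.eval₂Hom (cst K (X l)) (frac K l) (C c)) = _
      rw [MvPolynomial.eval₂Hom_C, awayToFunctionField_cst] }

/-- On a form of degree `n`, `formToFunctionField l F` is the rational function of `F/x_lⁿ`.
[folklore] -/
theorem formToFunctionField_of_mem (l : Fin (d + 1)) {n : ℕ} {F : MvPolynomial (Fin (d + 1)) K}
    (hF : F ∈ grading (Fin (d + 1)) K (n • 1)) :
    formToFunctionField l F = awayToFunctionField l (Away.mk _ (X_mem K l) n F hF) := by
  change awayToFunctionField l (MvPolynomial.eval₂Hom (cst K (X l)) (frac K l) F) = _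
  rw [← awayMk_eq_eval₂]

/-- Membership in the degree-`n` piece, in the form `n • 1` used by `HomogeneousLocalization.Away.mk`.
[folklore] -/
theorem mem_smul_one {n : ℕ} {F : MvPolynomial (Fin (d + 1)) K}
    (hF : F ∈ grading (Fin (d + 1)) K n) : F ∈ grading (Fin (d + 1)) K (n • 1) := by
  simpa using hF

/-- **`F/x₀ⁿ` is a global section of `𝒪(n • H)`** for a form `F` of degree `n`: on `D₊(x_l)`,
`(x₀/x_l)ⁿ · F/x₀ⁿ = F/x_lⁿ` is regular. [folklore] -/
theorem isSection_formToFunctionField {n : ℕ} {F : MvPolynomial (Fin (d + 1)) K}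
    (hF : F ∈ grading (Fin (d + 1)) K n) :
    (n • hyperplane d K).IsSection (formToFunctionField 0 F) := by
  intro i y hy
  set l := i.down.1 with hl
  change IsRegularAt y ((hyperplane d K).f i ^ n * formToFunctionField 0 F)
  rw [hyperplane_f, formToFunctionField_of_mem 0 (mem_smul_one hF)]
  obtain ⟨ρ, -, hρl, hρ0⟩ := exists_awayToFunctionField_eq_comp_awayMap (d := d) (K := K) l 0
  rw [hρl, hρ0, RingHom.comp_apply, RingHom.comp_apply, ← map_pow, ← map_mul,
    awayMap_frac_pow_mul_awayMap_mk, ← RingHom.comp_apply, ← hρl]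
  exact isRegularAt_awayToFunctionField l _ hy

variable (d K) in
/-- **Forms of degree `n` as sections of `𝒪(n • H)`**: the `K`-linear map `K[x]_n → Γ(ℙ^d, 𝒪(n • H))`,
`F ↦ F/x₀ⁿ`. [folklore] -/
def formToSectionsMap (n : ℕ) :
    grading (Fin (d + 1)) K n →ₗ[K] (n • hyperplane d K).sections K :=
  LinearMap.codRestrict ((n • hyperplane d K).sections K)
    ((formToFunctionField (d := d) (K := K) 0).toLinearMap.domRestrict (grading (Fin (d + 1)) K n))
    fun F => isSection_formToFunctionField F.2

/-- Unfolding: the rational function underlying `formToSectionsMap n F` is `F/x₀ⁿ`. [folklore] -/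
@[simp]
theorem formToSectionsMap_apply (n : ℕ) (F : grading (Fin (d + 1)) K n) :
    ((formToSectionsMap d K n F : (n • hyperplane d K).sections K) : (P d K).functionField) =
      formToFunctionField 0 (F : MvPolynomial (Fin (d + 1)) K) := rfl

/-- `F ↦ F/x₀ⁿ` is injective on forms of degree `n` (`K[x]` is a domain). [folklore] -/
theorem formToSectionsMap_injective (n : ℕ) : Function.Injective (formToSectionsMap d K n) := by
  intro F G h
  have h' : formToFunctionField 0 (F : MvPolynomial (Fin (d + 1)) K) =
      formToFunctionField 0 (G : MvPolynomial (Fin (d + 1)) K) := by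
    rw [← formToSectionsMap_apply, ← formToSectionsMap_apply, h]
  rw [formToFunctionField_of_mem 0 (mem_smul_one F.2),
    formToFunctionField_of_mem 0 (mem_smul_one G.2)] at h'
  have h2 := congrArg HomogeneousLocalization.val (awayToFunctionField_injective 0 h')
  simp only [Away.val_mk, Localization.mk_eq_mk_iff, Localization.r_iff_exists] at h2
  obtain ⟨⟨c, hc⟩, e⟩ := h2
  obtain ⟨k, rfl⟩ := hc
  apply Subtype.ext
  have hne : (X 0 : MvPolynomial (Fin (d + 1)) K) ^ k * X 0 ^ n ≠ 0 :=
    mul_ne_zero (pow_ne_zero _ (MvPolynomial.X_ne_zero _)) (pow_ne_zero _ (MvPolynomial.X_ne_zero _))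
  have e' : X 0 ^ k * X 0 ^ n * (F : MvPolynomial (Fin (d + 1)) K) =
      X 0 ^ k * X 0 ^ n * (G : MvPolynomial (Fin (d + 1)) K) := by
    simpa [mul_assoc] using e
  exact mul_left_cancel₀ hne e'

/-! ### Every section is a form: divisibility in `K[x]` -/

/-- A homogeneous polynomial divisible by `x₀^c` has a homogeneous quotient of the complementary
degree. [folklore] -/
theorem isHomogeneous_of_X_pow_mul {c n : ℕ} {G₁ : MvPolynomial (Fin (d + 1)) K}
    (hG : (X 0 ^ c * G₁).IsHomogeneous (n + c)) : G₁.IsHomogeneous n := by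
  classical
  intro m hm
  have hcoeff : MvPolynomial.coeff (Finsupp.single 0 c + m) (X 0 ^ c * G₁) ≠ 0 := by
    rw [MvPolynomial.X_pow_eq_monomial, MvPolynomial.coeff_monomial_mul']
    simp only [le_add_iff_nonneg_right, zero_le, ↓reduceIte, one_mul, add_tsub_cancel_left]
    exact hm
  have h := hG hcoeff
  have hdeg : (Finsupp.single 0 c + m).degree = n + c := by
    rw [Finsupp.degree_eq_weight_one]; exact h
  rw [map_add, Finsupp.degree_single] at hdeg
  have hm' : m.degree = n := by omega
  rw [Finsupp.degree_eq_weight_one] at hm'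
  exact hm'

/-- Over `ℙ⁰` (one variable) a form of degree `n + c` is a multiple of `x₀^c`. [folklore] -/
theorem X_pow_dvd_of_isHomogeneous_fin_one (hd : d = 0) {n c : ℕ}
    {G : MvPolynomial (Fin (d + 1)) K} (hG : G.IsHomogeneous (n + c)) : X 0 ^ c ∣ G := by
  subst hd
  classical
  set a := MvPolynomial.coeff (Finsupp.single 0 (n + c)) G with ha
  have hG' : G = C a * X 0 ^ (n + c) := by
    ext m
    rw [MvPolynomial.coeff_C_mul, MvPolynomial.X_pow_eq_monomial, MvPolynomial.coeff_monomial]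
    have hm : m = Finsupp.single 0 (m 0) := by
      ext i; fin_cases i; simp
    by_cases h : Finsupp.single (0 : Fin (0 + 1)) (n + c) = m
    · rw [if_pos h, mul_one, ← h]
    · rw [if_neg h, mul_zero]
      by_contra hne
      have hw := hG hne
      have hw' : m.degree = n + c := by
        rw [Finsupp.degree_eq_weight_one]; exact hw
      rw [Finsupp.degree_eq_sum, Fin.sum_univ_one] at hw'
      exact h (by rw [hm, hw'])
  exact ⟨C a * X 0 ^ n, by rw [hG']; ring⟩

/-- **The key divisibility** (`d ≥ 1`): if `G/x₀^{n+c}` (with `G` a form of degree `n + c`) becomes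
regular on `D₊(x₁)` after multiplication by `(x₀/x₁)ⁿ`, then `x₀^c ∣ G`. Read in the joint chart
`(K[x]_{(x₁x₀)})₀ ↪ K(ℙ^d)`, the hypothesis is an identity of fractions which, cleared of
denominators in the domain `K[x]`, says `x₀^c ∣ x₁^N G`; and `x₀` is prime to `x₁`
(Mathlib `MvPolynomial.X_prime`). [folklore] -/
theorem X_pow_dvd_of_isRegular {l₁ : Fin (d + 1)} (hl₁ : l₁ ≠ 0) {n c : ℕ}
    {G : MvPolynomial (Fin (d + 1)) K} (hG : G ∈ grading (Fin (d + 1)) K ((n + c) • 1))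
    (hreg : ∀ y ∈ U (d := d) (K := K) l₁,
      IsRegularAt y (awayToFunctionField l₁ (frac K l₁ 0) ^ n *
        awayToFunctionField 0 (Away.mk (grading (Fin (d + 1)) K) (X_mem K 0) (n + c) G hG))) :
    X 0 ^ c ∣ G := by
  -- the regular function comes from the chart `D₊(x₁)`
  obtain ⟨b, hb⟩ := exists_eq_awayToFunctionField l₁ hreg
  obtain ⟨m', G', hG', rfl⟩ := Away.mk_surjective (grading (Fin (d + 1)) K) (X_mem K l₁) b
  -- read it in the joint chart
  obtain ⟨ρ, hinj, hρ1, hρ0⟩ := exists_awayToFunctionField_eq_comp_awayMap (d := d) (K := K) l₁ 0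
  rw [hρ1, hρ0, RingHom.comp_apply, RingHom.comp_apply, RingHom.comp_apply, ← map_pow, ← map_mul]
    at hb
  have hval := congrArg HomogeneousLocalization.val (hinj hb)
  simp only [val_mul, val_pow, frac, Away.isLocalizationElem, awayMap_mk, Away.val_mk,
    Localization.mk_pow, Localization.mk_mul, Localization.mk_eq_mk_iff,
    Localization.r_iff_exists] at hval
  obtain ⟨⟨cc, hcc⟩, e⟩ := hval
  obtain ⟨k, rfl⟩ := hcc
  simp only [Submonoid.coe_mul, SubmonoidClass.coe_pow] at e
  -- `e` is a polynomial identity; extract `x₀^c ∣ x₁^N G`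
  have hX0 : (X 0 : MvPolynomial (Fin (d + 1)) K) ≠ 0 := MvPolynomial.X_ne_zero _
  have key : X 0 ^ (k + 2 * n + m') * (X l₁ ^ (k + n + c + m') * G) =
      X 0 ^ (k + 2 * n + m') * (X l₁ ^ (k + 2 * n + c) * X 0 ^ c * G') := by
    have e' := e
    ring_nf at e' ⊢
    linear_combination (-1 : MvPolynomial (Fin (d + 1)) K) * e'
  have key' := mul_left_cancel₀ (pow_ne_zero _ hX0) key
  have hdvd : X 0 ^ c ∣ X l₁ ^ (k + n + c + m') * G :=
    ⟨X l₁ ^ (k + 2 * n + c) * G', by rw [key']; ring⟩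
  have hp : Prime (X 0 : MvPolynomial (Fin (d + 1)) K) := MvPolynomial.X_prime
  refine hp.pow_dvd_of_dvd_mul_left c ?_ hdvd
  intro h
  have h1 : (X 0 : MvPolynomial (Fin (d + 1)) K) ∣ X l₁ := hp.dvd_of_dvd_pow h
  rw [MvPolynomial.X_dvd_X] at h1
  exact hl₁ h1.symm

/-- **Every global section of `𝒪(n • H)` is `F/x₀ⁿ` for a form `F` of degree `n`**
(Görtz–Wedhorn I, Example 13.16). [cite: GortzWedhorn2020, Example 13.16] -/
theorem formToSectionsMap_surjective (n : ℕ) : Function.Surjective (formToSectionsMap d K n) := by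
  rintro ⟨s, hs⟩
  -- `s` is regular on `D₊(x₀)` (the local equation there is `x₀/x₀ = 1`)
  have hs0 : ∀ y ∈ U (d := d) (K := K) 0, IsRegularAt y s := by
    intro y hy
    have h := hs ⟨⟨0, genericPoint_mem_U 0⟩⟩ y hy
    change IsRegularAt y ((hyperplane d K).f _ ^ n * s) at h
    rw [hyperplane_f] at h
    change IsRegularAt y (awayToFunctionField 0 (frac K 0 0) ^ n * s) at h
    rwa [frac_self, map_one, one_pow, one_mul] at h
  obtain ⟨a, ha⟩ := exists_eq_awayToFunctionField 0 hs0
  obtain ⟨m, G, hG, rfl⟩ := Away.mk_surjective (grading (Fin (d + 1)) K) (X_mem K 0) a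
  -- normalise the exponent: either `m ≤ n` (pad with `x₀`) or `m = n + c` (divide by `x₀^c`)
  rcases le_or_gt m n with hmn | hmn
  · obtain ⟨c, rfl⟩ := Nat.exists_eq_add_of_le hmn
    have hF : G * X 0 ^ c ∈ grading (Fin (d + 1)) K (m + c) := by
      have := SetLike.mul_mem_graded hG (SetLike.pow_mem_graded c (X_mem K 0))
      simpa [smul_eq_mul, add_mul] using this
    refine ⟨⟨G * X 0 ^ c, hF⟩, Subtype.ext ?_⟩
    rw [formToSectionsMap_apply, formToFunctionField_of_mem 0 (mem_smul_one hF)]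
    change _ = s
    rw [← ha]
    congr 1
    apply val_injective
    simp only [Away.val_mk, Localization.mk_eq_mk_iff, Localization.r_iff_exists]
    exact ⟨1, by simp; ring⟩
  · obtain ⟨c, rfl⟩ := Nat.exists_eq_add_of_lt hmn
    -- `x₀^(c+1) ∣ G`
    have hGhom : G.IsHomogeneous (n + (c + 1)) := by
      have := hG; simp only [smul_eq_mul, mul_one] at this
      simpa [add_assoc] using this
    have hdiv : X 0 ^ (c + 1) ∣ G := by
      rcases Nat.eq_zero_or_pos d with hd | hd
      · exact X_pow_dvd_of_isHomogeneous_fin_one hd hGhom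
      · set l₁ : Fin (d + 1) := ⟨1, by omega⟩ with hl₁
        have hl₁0 : l₁ ≠ 0 := fun h => by
          have := congrArg Fin.val h
          simp [hl₁] at this
        refine X_pow_dvd_of_isRegular (n := n) (c := c + 1) hl₁0 hG fun y hy => ?_
        have h := hs ⟨⟨l₁, genericPoint_mem_U _⟩⟩ y hy
        change IsRegularAt y ((hyperplane d K).f _ ^ n * s) at h
        rw [hyperplane_f, ← ha] at h
        exact h
    obtain ⟨G₁, rfl⟩ := hdiv
    have hG₁ : G₁ ∈ grading (Fin (d + 1)) K n :=
      (MvPolynomial.mem_homogeneousSubmodule n G₁).2 (isHomogeneous_of_X_pow_mul (by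
        simpa [add_comm, add_assoc] using hGhom))
    refine ⟨⟨G₁, hG₁⟩, Subtype.ext ?_⟩
    rw [formToSectionsMap_apply, formToFunctionField_of_mem 0 (mem_smul_one hG₁)]
    change _ = s
    rw [← ha]
    congr 1
    apply val_injective
    simp only [Away.val_mk, Localization.mk_eq_mk_iff, Localization.r_iff_exists]
    exact ⟨1, by simp; ring⟩

variable (d K) in
/-- **`Γ(ℙ^d_K, 𝒪(n • H)) ≅ K[x₀, …, x_d]_n`**, `F/x₀ⁿ ↤ F` (Görtz–Wedhorn I, Example 13.16:
"`Γ(ℙⁿ_R, 𝒪(d)) = R[X₀,…,Xₙ]_d` for `d ≥ 0`"; Hartshorne II Prop. 5.13). [cite: GortzWedhorn2020, Example 13.16] -/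
def formToSections (n : ℕ) : grading (Fin (d + 1)) K n ≃ₗ[K] (n • hyperplane d K).sections K :=
  LinearEquiv.ofBijective (formToSectionsMap d K n)
    ⟨formToSectionsMap_injective n, formToSectionsMap_surjective n⟩

/-! ### Counting monomials -/

/-- Monomials of degree `n` in the variables `Fin (d + 1)` correspond to multisets of size `n`:
Mathlib's `Sym.equivNatSum`, up to rewriting `Finsupp.degree` as `Finsupp.sum _ (fun _ => id)`
(`Finsupp.degree_apply`). [folklore] -/
def monomialsEquivSym (n : ℕ) :
    {m : Fin (d + 1) →₀ ℕ // m.degree = n} ≃ Sym (Fin (d + 1)) n :=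
  (Equiv.subtypeEquivRight fun m => by rw [Finsupp.degree_apply]; exact Iff.rfl).trans
    (Sym.equivNatSum _ n).symm

/-- There are `C(n + d, d)` monomials of degree `n` in `d + 1` variables
(`Sym.card_sym_eq_multichoose`). [folklore] -/
theorem card_monomials (n : ℕ) :
    Nat.card {m : Fin (d + 1) →₀ ℕ // m.degree = n} = (n + d).choose d := by
  rw [Nat.card_congr (monomialsEquivSym (d := d) n), Nat.card_eq_fintype_card,
    Sym.card_sym_eq_multichoose, Fintype.card_fin, Nat.multichoose_eq,
    show d + 1 + n - 1 = n + d by omega, Nat.choose_symm_add]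

variable (d K) in
/-- **`dim_K K[x₀, …, x_d]_n = C(n + d, d)`** (the monomials of degree `n` form a basis,
`MvPolynomial.homogeneousSubmodule_eq_finsupp_supported`; no global `Fintype` instance on the
monomial subtype is registered — a local one is used). [folklore] -/
theorem finrank_homogeneousSubmodule (n : ℕ) :
    Module.finrank K (grading (Fin (d + 1)) K n) = (n + d).choose d := by
  classical
  have e1 : (grading (Fin (d + 1)) K n : Submodule K (MvPolynomial (Fin (d + 1)) K)) =
      AddMonoidAlgebra.supported K K {m : Fin (d + 1) →₀ ℕ | m.degree = n} :=
    MvPolynomial.homogeneousSubmodule_eq_finsupp_supported (Fin (d + 1)) K n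
  let e : grading (Fin (d + 1)) K n ≃ₗ[K] ({m : Fin (d + 1) →₀ ℕ // m.degree = n} →₀ K) :=
    (LinearEquiv.ofEq _ _ e1).trans (AddMonoidAlgebra.supportedEquivFinsupp _)
  letI : Fintype {m : Fin (d + 1) →₀ ℕ // m.degree = n} :=
    Fintype.ofEquiv _ (monomialsEquivSym (d := d) n).symm
  rw [e.finrank_eq, (Finsupp.linearEquivFunOnFinite K K _).finrank_eq,
    Module.finrank_fintype_fun_eq_card, ← Nat.card_eq_fintype_card, card_monomials]

/-! ### `h⁰(ℙ^d, 𝒪(n)) = C(n + d, d)` -/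

/-- The spaces of sections `Γ(ℙ^d_K, 𝒪(n • H))` are finite-dimensional. [folklore] -/
instance finiteDimensional_sections (n : ℕ) :
    FiniteDimensional K ((n • hyperplane d K).sections K) := by
  haveI : FiniteDimensional K (grading (Fin (d + 1)) K n) :=
    Module.Finite.iff_fg.2 (MvPolynomial.homogeneousSubmodule_fg (Fin (d + 1)) K n)
  exact LinearEquiv.finiteDimensional (formToSections d K n)

variable (d K) in
/-- **`h⁰(ℙ^d_K, 𝒪(n • H)) = C(n + d, d)`** for every `n ≥ 0` (Görtz–Wedhorn I, Example 13.16 with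
the count of monomials; Hartshorne III Thm. 5.1 (a) in degree `0`). [cite: GortzWedhorn2020, Example 13.16] -/
theorem h0_hyperplane (n : ℕ) : (n • hyperplane d K).h0 K = (n + d).choose d := by
  rw [CartierDivisor.h0, ← (formToSections d K n).finrank_eq, finrank_homogeneousSubmodule]

end ProjSpace

end Literature.AlgebraicGeometry.Motives

end
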